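import Literature.NumberTheory.EllipticCurves.PAdicLFunctionTameMinusBirchMeasureProofs
import HarnessLib

/-!
# Birch's lemma at the level of the measures for the MINUS measure of the twist: `[x]⁻_g = c · Σ_b χ(b) [x + b/m]^∓_f` makes
# `μ⁻_{g, χ(p)α}` the `χ`-weighted minus (even `χ`) resp. plus (odd `χ`) tame measure of `f` (PROOFS ONLY)

`Proofs` companion (theorems only; no definition, no named fact) — the remaining two of the four measure-level Birch lemmas
(`msdMeasure_twist_eq_sum_msdMeasureTame`: plus/plus, even `χ`; `msdMeasure_twist_eq_sum_msdMeasureTameMinus`: plus/minus, odd `χ`):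
here the MINUS measure `μ⁻_g = msdMinusMeasure g` of the twisted form (`g = f ⊗ χ`) is read on the tame measures of `f`, from the
minus-symbol relations of `CuspFormTwistRatMinusSymbol` (`[x]⁻_g = c·Σχ(b)[x+b/m]⁻_f` for even `χ`, `= c·Σχ(b)[x+b/m]⁺_f` for odd `χ`;
Mazur–Tate–Teitelbaum §I.8). The Chinese-remainder algebra is that of the plus file, word for word:

* **`msdMinusMeasure_twist_eq_sum_msdMeasureTameMinus`** (even `χ`): `μ⁻_{g,χ(p)α}(a + pⁿℤ_p) = c·Σ_b χ(b)·μ⁻_{f,α,m}((a·m + pⁿℤ_p) × {b})`;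
* **`msdMinusMeasure_twist_eq_sum_msdMeasureTame`** (odd `χ`): `μ⁻_{g,χ(p)α}(a + pⁿℤ_p) = c·Σ_b χ(b)·μ_{f,α,m}((a·m + pⁿℤ_p) × {b})`.

These feed the Birch transport of the odd branch `padicLFunctionMinusBranch g (χ(p)α) 1` (crux stmt-BirchSwinnertonDyer-20368 road (C),
odd classes; memo `Cruxes/SplitBadTwoRankOneOfFacts/PERIOD-CANCELS-w8g24.md` §6–§7).

References: B. Mazur, J. Tate, J. Teitelbaum, Invent. Math. 84 (1986), §I.8–§I.10 [MazurTateTeitelbaum1986Invent]; K. Matsuno,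
J. Number Theory 84 (2000), §2 (p. 84) [Matsuno2000].
-/

noncomputable section

open scoped MatrixGroups ModularForm

open CongruenceSubgroup Literature.NumberTheory.EllipticCurves.ModularForms

namespace Literature.NumberTheory.EllipticCurves

section BirchMinus

variable {N N' : ℕ} [NeZero N] [NeZero N'] (f : CuspForm (Gamma0 N) 2) (g : CuspForm (Gamma0 N') 2)
  {p : ℕ} [Fact p.Prime] {m : ℕ} [NeZero m]

omit [NeZero N'] in
/-- **Birch's lemma at the level of the measures, MINUS measure of the twist, EVEN `χ`**: under
`hB : ∀ x, [x]⁻_g = c · Σ_{b mod m} χ(b) [x + b/m]⁻_f` (`χ(p)² = 1`, `(m,p) = 1`), for every `n` and `a mod pⁿ`,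
`μ⁻_{g, χ(p)α}(a + pⁿℤ_p) = c · Σ_{b mod m} χ(b) · μ⁻_{f,α,m}((a·m + pⁿℤ_p) × {b})`. [cite: MazurTateTeitelbaum1986Invent, §I.8–I.10 (pp. 10–13)]
[cite: Matsuno2000, §2 (p. 84)] -/
theorem msdMinusMeasure_twist_eq_sum_msdMeasureTameMinus (hmp : m.Coprime p) (χ : MulChar (ZMod m) ℚ)
    (hχp : χ (p : ZMod m) ^ 2 = 1) {c : ℚ}
    (hB : ∀ x : ℚ, ratMinusSymbol g x = c * ∑ b : ZMod m, χ b * ratMinusSymbol f (x + (b.val : ℚ) / m))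
    (α : ℚ_[p]) : ∀ (n : ℕ) (a : ZMod (p ^ n)),
    msdMinusMeasure g (((χ (p : ZMod m) : ℚ) : ℚ_[p]) * α) n a =
      (c : ℚ_[p]) * ∑ b : ZMod m, ((χ b : ℚ) : ℚ_[p]) * msdMeasureTameMinus f m α n (a * (m : ZMod (p ^ n))) b := by
  have hp : p.Prime := Fact.out
  -- `χ(p)⁻¹ = χ(p)` and `χ(pⁿ) = χ(p)ⁿ`
  have hχp1 : χ (p : ZMod m) ≠ 0 := by
    intro h; rw [h] at hχp; norm_num at hχp
  have hinv : (((χ (p : ZMod m) : ℚ) : ℚ_[p]))⁻¹ = ((χ (p : ZMod m) : ℚ) : ℚ_[p]) := by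
    have h2 : ((χ (p : ZMod m) : ℚ) : ℚ_[p]) * ((χ (p : ZMod m) : ℚ) : ℚ_[p]) = 1 := by
      rw [← Rat.cast_mul, ← pow_two, hχp, Rat.cast_one]
    exact inv_eq_of_mul_eq_one_right h2
  have hpow : ∀ n : ℕ, χ ((p : ZMod m) ^ n) = χ (p : ZMod m) ^ n := fun n ↦ map_pow χ _ n
  -- the two Birch sums, cast to `ℚ_p`
  have key1 : ∀ (n : ℕ) (a : ZMod (p ^ n)),
      (c : ℚ_[p]) * ∑ b : ZMod m, ((χ b : ℚ) : ℚ_[p]) *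
        (ratMinusSymbol f (tameFraction p m n (a * (m : ZMod (p ^ n))) b) : ℚ_[p]) =
        ((χ (p : ZMod m) : ℚ) : ℚ_[p]) ^ n * (ratMinusSymbol g ((a.val : ℚ) / (p : ℚ) ^ n) : ℚ_[p]) := by
    intro n a
    have h := sum_mul_ratMinusSymbol_tameFraction_eq f hmp χ n a
    rw [hpow] at h
    have h' := congrArg (fun q : ℚ ↦ ((c * q : ℚ) : ℚ_[p])) h
    rw [hB ((a.val : ℚ) / (p : ℚ) ^ n)]
    push_cast at h' ⊢
    rw [h']
    ring
  have key2 : ∀ (n : ℕ) (a : ZMod (p ^ n)),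
      (c : ℚ_[p]) * ∑ b : ZMod m, ((χ b : ℚ) : ℚ_[p]) *
        (ratMinusSymbol f ((p : ℚ) * tameFraction p m n (a * (m : ZMod (p ^ n))) b) : ℚ_[p]) =
        ((χ (p : ZMod m) : ℚ) : ℚ_[p]) ^ (n + 1) *
          (ratMinusSymbol g ((p : ℚ) * ((a.val : ℚ) / (p : ℚ) ^ n)) : ℚ_[p]) := by
    intro n a
    have h := sum_mul_ratMinusSymbol_prime_mul_tameFraction_eq f hmp χ n a
    rw [hpow] at h
    -- multiply by `χ(p)` and use `χ(p)² = 1`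
    have h1 : ∑ b : ZMod m, χ b * ratMinusSymbol f ((p : ℚ) * tameFraction p m n (a * (m : ZMod (p ^ n))) b) =
        χ (p : ZMod m) ^ (n + 1) *
          ∑ b : ZMod m, χ b * ratMinusSymbol f ((p : ℚ) * ((a.val : ℚ) / (p : ℚ) ^ n) + (b.val : ℚ) / m) := by
      have := congrArg (fun q ↦ χ (p : ZMod m) * q) h
      rw [← mul_assoc, ← pow_two, hχp, one_mul] at this
      rw [this]
      ring
    have h' := congrArg (fun q : ℚ ↦ ((c * q : ℚ) : ℚ_[p])) h1
    rw [hB ((p : ℚ) * ((a.val : ℚ) / (p : ℚ) ^ n))]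
    push_cast at h' ⊢
    rw [h']
    ring
  intro n a
  -- expand the right-hand side
  have hRHS : (c : ℚ_[p]) * ∑ b : ZMod m, ((χ b : ℚ) : ℚ_[p]) * msdMeasureTameMinus f m α n (a * (m : ZMod (p ^ n))) b =
      α⁻¹ ^ n * ((c : ℚ_[p]) * ∑ b : ZMod m, ((χ b : ℚ) : ℚ_[p]) *
        (ratMinusSymbol f (tameFraction p m n (a * (m : ZMod (p ^ n))) b) : ℚ_[p])) -
      α⁻¹ ^ (n + 1) * ((c : ℚ_[p]) * ∑ b : ZMod m, ((χ b : ℚ) : ℚ_[p]) *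
        (ratMinusSymbol f ((p : ℚ) * tameFraction p m n (a * (m : ZMod (p ^ n))) b) : ℚ_[p])) := by
    simp only [msdMeasureTameMinus, Finset.mul_sum, ← Finset.sum_sub_distrib]
    refine Finset.sum_congr rfl fun b _ ↦ ?_
    ring
  rw [hRHS, key1, key2]
  cases n with
  | zero =>
    have ha : a.val = 0 := by
      have h1 : a.val < p ^ 0 := ZMod.val_lt a
      have h2 : p ^ 0 = 1 := rfl
      omega
    simp only [msdMinusMeasure, ha, Nat.cast_zero, zero_div, mul_zero, pow_zero, one_mul, zero_add, pow_one, mul_inv, hinv]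
    ring
  | succ n =>
    have hp0 : (p : ℚ) ≠ 0 := by exact_mod_cast hp.ne_zero
    have hx : (p : ℚ) * ((a.val : ℚ) / (p : ℚ) ^ (n + 1)) = (a.val : ℚ) / (p : ℚ) ^ n := by
      rw [pow_succ (p : ℚ) n]; field_simp
    simp only [msdMinusMeasure, hx, mul_inv, inv_pow, hinv]
    ring

omit [NeZero N'] in
/-- **Birch's lemma at the level of the measures, MINUS measure of the twist, ODD `χ`**: under
`hB : ∀ x, [x]⁻_g = c · Σ_{b mod m} χ(b) [x + b/m]⁺_f` (the shape of `exists_rat_forall_ratMinusSymbol_charTwist_eq_of_odd`), for every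
`n` and `a mod pⁿ`, `μ⁻_{g, χ(p)α}(a + pⁿℤ_p) = c · Σ_{b mod m} χ(b) · μ_{f,α,m}((a·m + pⁿℤ_p) × {b})` (PLUS tame measure of `f`).
[cite: MazurTateTeitelbaum1986Invent, §I.8–I.10 (pp. 10–13)] [cite: Matsuno2000, §2 (p. 84)] -/
theorem msdMinusMeasure_twist_eq_sum_msdMeasureTame (hmp : m.Coprime p) (χ : MulChar (ZMod m) ℚ)
    (hχp : χ (p : ZMod m) ^ 2 = 1) {c : ℚ}
    (hB : ∀ x : ℚ, ratMinusSymbol g x = c * ∑ b : ZMod m, χ b * ratPlusSymbol f (x + (b.val : ℚ) / m))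
    (α : ℚ_[p]) : ∀ (n : ℕ) (a : ZMod (p ^ n)),
    msdMinusMeasure g (((χ (p : ZMod m) : ℚ) : ℚ_[p]) * α) n a =
      (c : ℚ_[p]) * ∑ b : ZMod m, ((χ b : ℚ) : ℚ_[p]) * msdMeasureTame f m α n (a * (m : ZMod (p ^ n))) b := by
  have hp : p.Prime := Fact.out
  -- `χ(p)⁻¹ = χ(p)` and `χ(pⁿ) = χ(p)ⁿ`
  have hχp1 : χ (p : ZMod m) ≠ 0 := by
    intro h; rw [h] at hχp; norm_num at hχp
  have hinv : (((χ (p : ZMod m) : ℚ) : ℚ_[p]))⁻¹ = ((χ (p : ZMod m) : ℚ) : ℚ_[p]) := by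
    have h2 : ((χ (p : ZMod m) : ℚ) : ℚ_[p]) * ((χ (p : ZMod m) : ℚ) : ℚ_[p]) = 1 := by
      rw [← Rat.cast_mul, ← pow_two, hχp, Rat.cast_one]
    exact inv_eq_of_mul_eq_one_right h2
  have hpow : ∀ n : ℕ, χ ((p : ZMod m) ^ n) = χ (p : ZMod m) ^ n := fun n ↦ map_pow χ _ n
  -- the two Birch sums, cast to `ℚ_p`
  have key1 : ∀ (n : ℕ) (a : ZMod (p ^ n)),
      (c : ℚ_[p]) * ∑ b : ZMod m, ((χ b : ℚ) : ℚ_[p]) *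
        (ratPlusSymbol f (tameFraction p m n (a * (m : ZMod (p ^ n))) b) : ℚ_[p]) =
        ((χ (p : ZMod m) : ℚ) : ℚ_[p]) ^ n * (ratMinusSymbol g ((a.val : ℚ) / (p : ℚ) ^ n) : ℚ_[p]) := by
    intro n a
    have h := sum_mul_ratPlusSymbol_tameFraction_eq f hmp χ n a
    rw [hpow] at h
    have h' := congrArg (fun q : ℚ ↦ ((c * q : ℚ) : ℚ_[p])) h
    rw [hB ((a.val : ℚ) / (p : ℚ) ^ n)]
    push_cast at h' ⊢
    rw [h']
    ring
  have key2 : ∀ (n : ℕ) (a : ZMod (p ^ n)),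
      (c : ℚ_[p]) * ∑ b : ZMod m, ((χ b : ℚ) : ℚ_[p]) *
        (ratPlusSymbol f ((p : ℚ) * tameFraction p m n (a * (m : ZMod (p ^ n))) b) : ℚ_[p]) =
        ((χ (p : ZMod m) : ℚ) : ℚ_[p]) ^ (n + 1) *
          (ratMinusSymbol g ((p : ℚ) * ((a.val : ℚ) / (p : ℚ) ^ n)) : ℚ_[p]) := by
    intro n a
    have h := sum_mul_ratPlusSymbol_prime_mul_tameFraction_eq f hmp χ n a
    rw [hpow] at h
    -- multiply by `χ(p)` and use `χ(p)² = 1`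
    have h1 : ∑ b : ZMod m, χ b * ratPlusSymbol f ((p : ℚ) * tameFraction p m n (a * (m : ZMod (p ^ n))) b) =
        χ (p : ZMod m) ^ (n + 1) *
          ∑ b : ZMod m, χ b * ratPlusSymbol f ((p : ℚ) * ((a.val : ℚ) / (p : ℚ) ^ n) + (b.val : ℚ) / m) := by
      have := congrArg (fun q ↦ χ (p : ZMod m) * q) h
      rw [← mul_assoc, ← pow_two, hχp, one_mul] at this
      rw [this]
      ring
    have h' := congrArg (fun q : ℚ ↦ ((c * q : ℚ) : ℚ_[p])) h1
    rw [hB ((p : ℚ) * ((a.val : ℚ) / (p : ℚ) ^ n))]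
    push_cast at h' ⊢
    rw [h']
    ring
  intro n a
  -- expand the right-hand side
  have hRHS : (c : ℚ_[p]) * ∑ b : ZMod m, ((χ b : ℚ) : ℚ_[p]) * msdMeasureTame f m α n (a * (m : ZMod (p ^ n))) b =
      α⁻¹ ^ n * ((c : ℚ_[p]) * ∑ b : ZMod m, ((χ b : ℚ) : ℚ_[p]) *
        (ratPlusSymbol f (tameFraction p m n (a * (m : ZMod (p ^ n))) b) : ℚ_[p])) -
      α⁻¹ ^ (n + 1) * ((c : ℚ_[p]) * ∑ b : ZMod m, ((χ b : ℚ) : ℚ_[p]) *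
        (ratPlusSymbol f ((p : ℚ) * tameFraction p m n (a * (m : ZMod (p ^ n))) b) : ℚ_[p])) := by
    simp only [msdMeasureTame, Finset.mul_sum, ← Finset.sum_sub_distrib]
    refine Finset.sum_congr rfl fun b _ ↦ ?_
    ring
  rw [hRHS, key1, key2]
  cases n with
  | zero =>
    have ha : a.val = 0 := by
      have h1 : a.val < p ^ 0 := ZMod.val_lt a
      have h2 : p ^ 0 = 1 := rfl
      omega
    simp only [msdMinusMeasure, ha, Nat.cast_zero, zero_div, mul_zero, pow_zero, one_mul, zero_add, pow_one, mul_inv, hinv]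
    ring
  | succ n =>
    have hp0 : (p : ℚ) ≠ 0 := by exact_mod_cast hp.ne_zero
    have hx : (p : ℚ) * ((a.val : ℚ) / (p : ℚ) ^ (n + 1)) = (a.val : ℚ) / (p : ℚ) ^ n := by
      rw [pow_succ (p : ℚ) n]; field_simp
    simp only [msdMinusMeasure, hx, mul_inv, inv_pow, hinv]
    ring

end BirchMinus

end Literature.NumberTheory.EllipticCurves

end
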